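import Literature.NumberTheory.GaloisRepresentations.LubinTate
import Mathlib.RingTheory.AdicCompletion.Basic
import HarnessLib

/-!
# The Frobenius-twisted Lubin–Tate lemma: `f' ∘ Φ = Φ^φ ∘ (f, …, f)` over `(A, φ)`

Topic `NumberTheory/GaloisRepresentations`; namespace
`Literature.NumberTheory.GaloisRepresentations.LubinTate` (continuation of `LubinTate.lean`).

Lubin–Tate's comparison of the formal groups attached to two uniformisers `π` and `π' = uπ`
(Lubin–Tate 1965, the Lemma before Thm. 3, pp. 385–386; Serre, *Local class field theory*,
Ch. VI of Cassels–Fröhlich, §3.7 Lemmas 1–2; de Shalit, *Iwasawa theory of elliptic curves*,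
Ch. I §1.3–§1.5, the "relative Lubin–Tate groups") takes place over the completion
`A = 𝒪̂_{K^nr}` of the maximal unramified extension, with its Frobenius `φ`: one needs power
series `Φ` over `A` satisfying a TWISTED commutation rule `f' ∘ Φ = Φ^φ ∘ f` (`Φ^φ` = `φ`
applied to the coefficients).  This file proves the corresponding twisted form of Lubin–Tate's
lemma (Lubin–Tate 1965 Lemma 1 / Cassels–Fröhlich VI §3.5 Prop. 5 is the case `φ = id`,
`π' = π`, file `LubinTate.lean`), over an abstract base:

* `LubinTate.exists_unique_eq_add_mul_map` — the CONTRACTION EQUATION `x = d + λ·φ(x)` has a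
  unique solution in a ring `A` complete and separated for `(π)`, for `φ : A →+* A` with
  `φ(π) = π` and `π ∣ λ` [folklore: successive approximation];
* `LubinTate.twistDefect φ f' f Φ = f' ∘ Φ - Φ^φ ∘ (f, …, f)` and the KEY CONGRUENCE
  `le_order_twistDefect_sub`: if `Φ' ≡ Φ (mod deg m+1)` then
  `D Φ' - D Φ ≡ π'(Φ' - Φ) - π^{m+1} (Φ' - Φ)^φ (mod deg m+2)` (from the accepted first-order
  expansions `le_order_compLeft_sub`, `le_order_compRight_sub`);
* `LubinTate.dvd_coeff_twistDefect` — every coefficient of `D Φ` is divisible by `π` when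
  `f ≡ f' ≡ X^q (mod π)` and `φ` LIFTS THE `q`-TH POWER MAP (`φ(a) ≡ a^q mod π`): modulo `π`,
  `Φ̄^q = (Φ̄^{φ̄})(X^q)` (Mathlib `MvPowerSeries.map_iterateFrobenius_expand`);
* `LubinTate.exists_unique_twist` — **the twisted Lubin–Tate lemma**: let `π` be a
  non-zero-divisor of `A`, `A` complete and separated for `(π)`, `q = p^r` with `p ∈ πA`,
  `φ : A →+* A` with `φ(π) = π` and `φ(a) ≡ a^q (mod π)`; let `f ∈ 𝔉_π` and `f' ∈ 𝔉_{π'}` with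
  `π' = uπ`, `u ∈ Aˣ`.  Then for every linear form `Σ aᵢ Xᵢ` there is a unique
  `Φ ∈ A⟦X₁,…,Xₙ⟧` with `Φ ≡ Σ aᵢ Xᵢ (mod deg 2)` and `f' ∘ Φ = Φ^φ ∘ (f, …, f)`.
  Proof: successive approximation as in the untwisted case, the correction `δ` of degree `m+2`
  now solving `π' δ - π^{m+2} φ(δ) = -(D Φ)_{m+2}`, i.e. the contraction equation
  `δ = -u⁻¹ c + u⁻¹ π^{m+1} φ(δ)` with `(D Φ)_{m+2} = π c`; uniqueness because
  `π' x = π^{m+2} φ(x)` forces `x ∈ ⋂ₖ π^k A = 0`.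

The application (Lubin–Tate's `ϑ` with `ϑ^φ = ϑ ∘ [u]_f`, the identification of the Lubin–Tate
characters of different uniformisers, the explicit reciprocity law) is the sequel.
No named facts.

## References

* [LubinTate1965] J. Lubin, J. Tate, *Formal complex multiplication in local fields*, Ann. of
  Math. 81 (1965), §1 Lemma 1 and the Lemma on pp. 385–386 (proof of Thm. 3).
* [CasselsFrohlichANT1967] J.-P. Serre, *Local class field theory*, Ch. VI of Cassels–Fröhlich,
  *Algebraic Number Theory* (1967), §3.5 Prop. 5, §3.7 Lemmas 1–2.
* [deShalit1987] E. de Shalit, *Iwasawa theory of elliptic curves with complex multiplication*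
  (1987), Ch. I §1.3–§1.5 (relative Lubin–Tate theory).
-/

noncomputable section

open MvPowerSeries

namespace Literature.NumberTheory.GaloisRepresentations

namespace LubinTate

variable {A : Type*} [CommRing A] {σ : Type*}

/-! ### Divisibility by powers of `π` and `(π)`-adic congruences -/

section Adic

variable (π : A)

/-- `x ∈ (π)^n • ⊤ ↔ π^n ∣ x`. [folklore] -/
theorem mem_span_pow_smul_top_iff {n : ℕ} {x : A} :
    x ∈ ((Ideal.span {π}) ^ n • ⊤ : Submodule A A) ↔ π ^ n ∣ x := by
  rw [Ideal.smul_eq_mul, Ideal.mul_top, Ideal.span_singleton_pow, Ideal.mem_span_singleton]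

/-- In a `(π)`-adically separated ring, an element divisible by every power of `π` is zero.
[folklore] -/
theorem eq_zero_of_forall_pow_dvd [IsHausdorff (Ideal.span {π}) A] {x : A}
    (h : ∀ n : ℕ, π ^ n ∣ x) : x = 0 := by
  refine IsHausdorff.haus' (I := Ideal.span {π}) x fun n => ?_
  rw [SModEq.sub_mem, sub_zero, mem_span_pow_smul_top_iff]
  exact h n

/-- A ring endomorphism fixing `π` preserves divisibility by `π^n`. [folklore] -/
theorem pow_dvd_map_of_pow_dvd (φ : A →+* A) (hφ : φ π = π) {n : ℕ} {x : A} (h : π ^ n ∣ x) :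
    π ^ n ∣ φ x := by
  obtain ⟨y, rfl⟩ := h
  exact ⟨φ y, by rw [map_mul, map_pow, hφ]⟩

/-- **The contraction equation `x = d + λ φ(x)`** (`φ(π) = π`, `π ∣ λ`) has a unique solution in
a `(π)`-adically complete and separated ring: the iterates `x₀ = 0`, `x_{k+1} = d + λ φ(x_k)`
converge (`x_{k+1} - x_k ∈ π^k A`), and two solutions differ by an element of `⋂ₖ π^k A = 0`.
[folklore] -/
theorem exists_unique_eq_add_mul_map [IsAdicComplete (Ideal.span {π}) A] (φ : A →+* A)
    (hφ : φ π = π) {lam : A} (hlam : π ∣ lam) (d : A) : ∃! x : A, x = d + lam * φ x := by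
  -- the iterates
  let xs : ℕ → A := fun k => Nat.rec 0 (fun _ x => d + lam * φ x) k
  have hxs0 : xs 0 = 0 := rfl
  have hxs : ∀ k, xs (k + 1) = d + lam * φ (xs k) := fun k => rfl
  have hstep : ∀ k, π ^ k ∣ xs (k + 1) - xs k := by
    intro k
    induction k with
    | zero => rw [pow_zero]; exact one_dvd _
    | succ k ih =>
      rw [hxs (k + 1), hxs k, add_sub_add_left_eq_sub, ← mul_sub, ← map_sub, pow_succ']
      exact mul_dvd_mul hlam (pow_dvd_map_of_pow_dvd π φ hφ ih)
  have htel : ∀ m n, m ≤ n → π ^ m ∣ xs n - xs m := by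
    intro m n hmn
    induction n, hmn using Nat.le_induction with
    | base => rw [sub_self]; exact dvd_zero _
    | succ n hmn ih =>
      have h1 : π ^ m ∣ xs (n + 1) - xs n := (pow_dvd_pow π hmn).trans (hstep n)
      have h2 := dvd_add h1 ih
      rwa [sub_add_sub_cancel] at h2
  obtain ⟨L, hL⟩ := IsPrecomplete.prec (I := Ideal.span {π}) (M := A) inferInstance (f := xs)
    (fun {m n} hmn => by
      rw [SModEq.sub_mem, mem_span_pow_smul_top_iff, ← dvd_neg, neg_sub]
      exact htel m n hmn)
  have hL' : ∀ n, π ^ n ∣ L - xs n := fun n => by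
    have h1 := hL n
    rw [SModEq.sub_mem, mem_span_pow_smul_top_iff, ← dvd_neg, neg_sub] at h1
    exact h1
  refine ⟨L, ?_, ?_⟩
  · -- `L` solves the equation: both sides agree modulo every `π^n`
    refine sub_eq_zero.mp (eq_zero_of_forall_pow_dvd π fun n => ?_)
    have h1 : π ^ n ∣ L - xs (n + 1) := (pow_dvd_pow π (Nat.le_succ n)).trans (hL' (n + 1))
    have h2 : π ^ n ∣ lam * φ (L - xs n) :=
      (pow_dvd_map_of_pow_dvd π φ hφ (hL' n)).mul_left lam
    have e : L - (d + lam * φ L) = (L - xs (n + 1)) - lam * φ (L - xs n) := by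
      rw [hxs n, map_sub]; ring
    rw [e]
    exact dvd_sub h1 h2
  · -- uniqueness
    intro y hy
    have hLfix : L = d + lam * φ L := by
      refine sub_eq_zero.mp (eq_zero_of_forall_pow_dvd π fun n => ?_)
      have h1 : π ^ n ∣ L - xs (n + 1) := (pow_dvd_pow π (Nat.le_succ n)).trans (hL' (n + 1))
      have h2 : π ^ n ∣ lam * φ (L - xs n) :=
        (pow_dvd_map_of_pow_dvd π φ hφ (hL' n)).mul_left lam
      have e : L - (d + lam * φ L) = (L - xs (n + 1)) - lam * φ (L - xs n) := by
        rw [hxs n, map_sub]; ring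
      rw [e]
      exact dvd_sub h1 h2
    refine sub_eq_zero.mp (eq_zero_of_forall_pow_dvd π fun n => ?_)
    have hdiff : y - L = lam * φ (y - L) := by
      conv_lhs => rw [hy, hLfix]
      rw [map_sub]; ring
    induction n with
    | zero => rw [pow_zero]; exact one_dvd _
    | succ n ih =>
      rw [hdiff, pow_succ']
      exact mul_dvd_mul hlam (pow_dvd_map_of_pow_dvd π φ hφ ih)

/-- The homogeneous equation: `x = λ φ(x)` with `π ∣ λ` forces `x = 0`. [folklore] -/
theorem eq_zero_of_eq_mul_map [IsAdicComplete (Ideal.span {π}) A] (φ : A →+* A)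
    (hφ : φ π = π) {lam : A} (hlam : π ∣ lam) {x : A} (hx : x = lam * φ x) : x = 0 := by
  have h := exists_unique_eq_add_mul_map π φ hφ hlam 0
  obtain ⟨z, -, hz⟩ := h
  have hx' : x = 0 + lam * φ x := by rw [zero_add]; exact hx
  have h0 : (0 : A) = 0 + lam * φ 0 := by rw [map_zero, mul_zero, add_zero]
  exact (hz x hx').trans (hz 0 h0).symm

end Adic

/-! ### The twisted defect `f' ∘ Φ - Φ^φ ∘ (f, …, f)` -/

section TwistDefect

variable [Fintype σ] (φ : A →+* A)

/-- The twisted defect `D Φ = f' ∘ Φ - Φ^φ ∘ (f, …, f)` (`Φ^φ = map φ Φ`).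
[cite: LubinTate1965, Lemma p. 385] -/
def twistDefect (f' f : PowerSeries A) (Φ : MvPowerSeries σ A) : MvPowerSeries σ A :=
  compLeft f' Φ - compRight f (MvPowerSeries.map φ Φ)

omit [Fintype σ] in
/-- `ord Φ ≤ ord Φ^φ`. [folklore] -/
theorem order_le_order_map (Φ : MvPowerSeries σ A) : Φ.order ≤ (MvPowerSeries.map φ Φ).order :=
  MvPowerSeries.le_order fun d hd => by rw [MvPowerSeries.coeff_map, coeff_of_lt_order hd, map_zero]

omit [Fintype σ] in
/-- `(Φ^φ)` has no constant term if `Φ` has none. [folklore] -/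
theorem constantCoeff_map_eq_zero_of_eq {Φ : MvPowerSeries σ A} (hΦ : Φ.constantCoeff = 0) :
    (MvPowerSeries.map φ Φ).constantCoeff = 0 := by
  rw [MvPowerSeries.constantCoeff_map, hΦ, map_zero]

/-- **Key congruence (twisted).**  For `f' ≡ π'X`, `f ≡ πX (mod deg 2)` and `Φ' ≡ Φ (mod deg m+1)`
(no constant terms): `D Φ' - D Φ ≡ π'(Φ' - Φ) - π^{m+1}(Φ' - Φ)^φ (mod deg m+2)`, where
`D = twistDefect φ f' f`. [cite: CasselsFrohlichANT1967, Ch. VI §3.5 Prop. 5 (proof)]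
[cite: LubinTate1965, Lemma p. 385] -/
theorem le_order_twistDefect_sub {f' f : PowerSeries A} {π' π : A}
    (hf'1 : PowerSeries.coeff 1 f' = π') (hf0 : PowerSeries.constantCoeff f = 0)
    (hf1 : PowerSeries.coeff 1 f = π) {Φ Φ' : MvPowerSeries σ A} (hΦ : Φ.constantCoeff = 0)
    (hΦ' : Φ'.constantCoeff = 0) {m : ℕ} (h : ((m + 1 : ℕ) : ℕ∞) ≤ (Φ' - Φ).order) :
    ((m + 2 : ℕ) : ℕ∞) ≤ (twistDefect φ f' f Φ' - twistDefect φ f' f Φ -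
      (MvPowerSeries.C π' * (Φ' - Φ) -
        MvPowerSeries.C (π ^ (m + 1)) * MvPowerSeries.map φ (Φ' - Φ))).order := by
  have h1 := le_order_compLeft_sub f' hΦ hΦ' h
  have h2 := le_order_compRight_sub (σ := σ) hf0 hf1 (ψ := MvPowerSeries.map φ (Φ' - Φ))
    (le_trans h (order_le_order_map φ _))
  rw [hf'1] at h1
  have hlin : compRight f (MvPowerSeries.map φ (Φ' - Φ)) =
      compRight f (MvPowerSeries.map φ Φ') - compRight f (MvPowerSeries.map φ Φ) := by
    rw [map_sub, compRight, compRight, compRight,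
      MvPowerSeries.subst_sub (hasSubst_compRight hf0)]
  have : twistDefect φ f' f Φ' - twistDefect φ f' f Φ -
      (MvPowerSeries.C π' * (Φ' - Φ) - MvPowerSeries.C (π ^ (m + 1)) * MvPowerSeries.map φ (Φ' - Φ)) =
      (compLeft f' Φ' - compLeft f' Φ - MvPowerSeries.C π' * (Φ' - Φ)) -
        (compRight f (MvPowerSeries.map φ (Φ' - Φ)) -
          MvPowerSeries.C (π ^ (m + 1)) * MvPowerSeries.map φ (Φ' - Φ)) := by
    rw [hlin, twistDefect, twistDefect]
    ring
  rw [this, sub_eq_add_neg]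
  refine le_trans (le_min h1 ?_) min_order_le_add
  rwa [order_neg]

/-- `twistDefect φ f' f 0 = 0` (for `f'` without constant term). [folklore] -/
theorem twistDefect_zero {f' f : PowerSeries A} (hf'0 : PowerSeries.constantCoeff f' = 0)
    (hf0 : PowerSeries.constantCoeff f = 0) : twistDefect φ f' f (0 : MvPowerSeries σ A) = 0 := by
  rw [twistDefect, compLeft, compRight, PowerSeries.subst_zero_of_constantCoeff_zero hf'0, map_zero,
    ← MvPowerSeries.coe_substAlgHom (hasSubst_compRight hf0), map_zero, sub_zero]

omit [Fintype σ] in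
/-- `(Σ aᵢ Xᵢ)^φ = Σ φ(aᵢ) Xᵢ`. [folklore] -/
theorem map_linearPart [Fintype σ] (a : σ → A) :
    MvPowerSeries.map φ (linearPart a) = linearPart (fun i => φ (a i)) := by
  simp only [linearPart, map_sum, map_mul, MvPowerSeries.map_C, MvPowerSeries.map_X]

/-- For a linear form with `π' aᵢ = π φ(aᵢ)` the linear terms of `π' φ₁` and `π φ₁^φ` cancel.
[folklore] -/
theorem C_mul_linearPart_sub_eq_zero {π' π : A} {a : σ → A} (ha : ∀ i, π' * a i = π * φ (a i)) :
    MvPowerSeries.C π' * linearPart a - MvPowerSeries.C π * MvPowerSeries.map φ (linearPart a) =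
      (0 : MvPowerSeries σ A) := by
  rw [map_linearPart, linearPart, linearPart, Finset.mul_sum, Finset.mul_sum, ← Finset.sum_sub_distrib]
  refine Finset.sum_eq_zero fun i _ => ?_
  rw [← mul_assoc, ← mul_assoc, ← map_mul, ← map_mul, ha i, sub_self]

/-- Stage one: `ord D(Σ aᵢXᵢ) ≥ 2` when `π' aᵢ = π φ(aᵢ)`. [folklore] -/
theorem two_le_order_twistDefect_linearPart {f' f : PowerSeries A} {π' π : A}
    (hf'0 : PowerSeries.constantCoeff f' = 0) (hf'1 : PowerSeries.coeff 1 f' = π')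
    (hf0 : PowerSeries.constantCoeff f = 0) (hf1 : PowerSeries.coeff 1 f = π) {a : σ → A}
    (ha : ∀ i, π' * a i = π * φ (a i)) :
    (2 : ℕ∞) ≤ (twistDefect φ f' f (linearPart a)).order := by
  have h := le_order_twistDefect_sub (σ := σ) φ hf'1 hf0 hf1 (Φ := 0) (Φ' := linearPart a) (m := 0)
    (by simp) (constantCoeff_linearPart a)
    (by rw [sub_zero]; exact_mod_cast
      (one_le_order_iff_constCoeff_eq_zero.mpr (constantCoeff_linearPart a)))
  rwa [twistDefect_zero φ hf'0 hf0, sub_zero, sub_zero, zero_add, pow_one,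
    C_mul_linearPart_sub_eq_zero φ ha, sub_zero] at h

end TwistDefect

/-! ### The base: Frobenius lift and divisibility of the defect by `π` -/

section Frobenius

variable [Fintype σ] {π : A} {q : ℕ} (φ : A →+* A)

/-- A series `f` with `π ∣ f_n - [n = q]` reduces to `X^q` modulo `π`. [folklore] -/
theorem map_mk_eq_X_pow_of_dvd {f : PowerSeries A}
    (hf : ∀ n, π ∣ PowerSeries.coeff n f - (if n = q then 1 else 0)) :
    f.map (Ideal.Quotient.mk (Ideal.span {π})) = PowerSeries.X ^ q := by
  ext n
  rw [PowerSeries.coeff_map, PowerSeries.coeff_X_pow]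
  have h := hf n
  rw [← Ideal.mem_span_singleton, ← Ideal.Quotient.eq_zero_iff_mem, map_sub, sub_eq_zero] at h
  rw [h]
  split_ifs <;> simp

/-- **The twisted defect is divisible by `π`**: if `f' ≡ f ≡ X^q (mod π)`, `φ(π) = π`,
`φ(a) ≡ a^q (mod π)` with `q = p^r`, `p ∈ πA`, then every coefficient of
`f' ∘ Φ - Φ^φ ∘ (f,…,f)` is divisible by `π`: modulo `π` it is `Φ̄^q - (Φ̄^{φ̄})(X^q) = 0`.
[cite: CasselsFrohlichANT1967, Ch. VI §3.5 Prop. 5 (proof)] [cite: LubinTate1965, Lemma p. 385] -/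
theorem dvd_coeff_twistDefect {p r : ℕ} (hp : p.Prime) (hq : q = p ^ r)
    (hpmem : (p : A) ∈ Ideal.span {π}) (hφq : ∀ a : A, π ∣ φ a - a ^ q)
    {f' f : PowerSeries A} (hf' : ∀ n, π ∣ PowerSeries.coeff n f' - (if n = q then 1 else 0))
    (hf : ∀ n, π ∣ PowerSeries.coeff n f - (if n = q then 1 else 0))
    (hf0 : PowerSeries.constantCoeff f = 0)
    {Φ : MvPowerSeries σ A} (hΦ : Φ.constantCoeff = 0) (e : σ →₀ ℕ) :
    π ∣ MvPowerSeries.coeff e (twistDefect φ f' f Φ) := by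
  rw [← Ideal.mem_span_singleton, ← Ideal.Quotient.eq_zero_iff_mem]
  rcases subsingleton_or_nontrivial (A ⧸ Ideal.span {π}) with hR | hR
  · exact Subsingleton.elim _ _
  haveI : Fact p.Prime := ⟨hp⟩
  haveI : CharP (A ⧸ Ideal.span {π}) p := (CharP.charP_iff_prime_eq_zero hp).mpr (by
    rw [show (p : A ⧸ Ideal.span {π}) = Ideal.Quotient.mk (Ideal.span {π}) (p : A) by simp,
      Ideal.Quotient.eq_zero_iff_mem]; exact hpmem)
  set mk := Ideal.Quotient.mk (Ideal.span {π}) with hmk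
  -- `mk ∘ φ = Frob^r ∘ mk`
  have hcomp : mk.comp φ = (iterateFrobenius (A ⧸ Ideal.span {π}) p r).comp mk := by
    ext a
    rw [RingHom.comp_apply, RingHom.comp_apply, iterateFrobenius_def, ← hq, ← map_pow, hmk,
      Ideal.Quotient.eq, Ideal.mem_span_singleton]
    exact hφq a
  rw [← MvPowerSeries.coeff_map, twistDefect, map_sub, compLeft, compRight,
    PowerSeries.map_subst (hasSubst_of_constantCoeff hΦ), map_mk_eq_X_pow_of_dvd hf',
    MvPowerSeries.map_subst (hasSubst_compRight hf0), MvPowerSeries.map_map, hcomp,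
    ← MvPowerSeries.map_map]
  have hX : ∀ i : σ, (PowerSeries.subst (MvPowerSeries.X i : MvPowerSeries σ A) f).map mk =
      (MvPowerSeries.X i) ^ q := by
    intro i
    rw [PowerSeries.map_subst (PowerSeries.HasSubst.of_constantCoeff_zero
      (MvPowerSeries.constantCoeff_X i)), map_mk_eq_X_pow_of_dvd hf, MvPowerSeries.map_X,
      PowerSeries.subst_pow (PowerSeries.HasSubst.of_constantCoeff_zero
        (MvPowerSeries.constantCoeff_X i)), PowerSeries.subst_X
        (PowerSeries.HasSubst.of_constantCoeff_zero (MvPowerSeries.constantCoeff_X i))]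
  have hΦm : PowerSeries.HasSubst (Φ.map mk) := by
    refine PowerSeries.HasSubst.of_constantCoeff_zero ?_
    rw [MvPowerSeries.constantCoeff_map, hΦ, map_zero]
  simp_rw [hX]
  rw [PowerSeries.subst_pow hΦm, PowerSeries.subst_X hΦm, hq,
    ← MvPowerSeries.map_iterateFrobenius_expand p hp.ne_zero (Φ.map mk) r, MvPowerSeries.map_expand,
    MvPowerSeries.expand, MvPowerSeries.coe_substAlgHom, sub_self, map_zero]

end Frobenius

/-! ### Existence: successive approximation with contraction corrections -/

section Existence

variable [Fintype σ] {π : A} {q : ℕ} (φ : A →+* A) {f' f : PowerSeries A} {u : Aˣ} {a : σ → A}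

/-- An approximate solution to order `m + 2`: `Φ ≡ Σ aᵢXᵢ (mod deg 2)`, `D Φ ≡ 0 (mod deg m+2)`.
[cite: LubinTate1965, Lemma p. 385] -/
structure TwApprox (φ : A →+* A) (f' f : PowerSeries A) (a : σ → A) (m : ℕ) where
  /-- the approximant [folklore] -/
  Φ : MvPowerSeries σ A
  constantCoeff_eq : Φ.constantCoeff = 0
  coeff_single : ∀ i, MvPowerSeries.coeff (Finsupp.single i 1) Φ = a i
  le_order : ((m + 2 : ℕ) : ℕ∞) ≤ (twistDefect φ f' f Φ).order

/-- Stage `0`: the linear part. [folklore] -/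
def TwApprox.zero (hf'0 : PowerSeries.constantCoeff f' = 0)
    (hf'1 : PowerSeries.coeff 1 f' = (u : A) * π) (hf0 : PowerSeries.constantCoeff f = 0)
    (hf1 : PowerSeries.coeff 1 f = π) (ha : ∀ i, φ (a i) = (u : A) * a i) :
    TwApprox φ f' f a 0 where
  Φ := linearPart a
  constantCoeff_eq := constantCoeff_linearPart a
  coeff_single := coeff_linearPart_single a
  le_order := two_le_order_twistDefect_linearPart φ hf'0 hf'1 hf0 hf1 fun i => by
    rw [ha i]; ring

/-- Hypotheses of the twisted lemma on the base `(A, π, q, φ)`: `π` is a non-zero-divisor,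
`q = p^r` with `p` prime and `p ∈ πA`, `φ(π) = π` and `φ` lifts the `q`-th power map.
(Completeness and separatedness for `(π)` are taken as the instance `IsAdicComplete`.)
[cite: LubinTate1965, Lemma p. 385] -/
structure IsTwistBase (π : A) (q : ℕ) (φ : A →+* A) : Prop where
  eq_zero_of_mul_eq_zero : ∀ x : A, π * x = 0 → x = 0
  exists_prime : ∃ p r : ℕ, p.Prime ∧ q = p ^ r ∧ (p : A) ∈ Ideal.span {π}
  map_eq : φ π = π
  dvd_map_sub_pow : ∀ a : A, π ∣ φ a - a ^ q

variable [IsAdicComplete (Ideal.span {π}) A] (hA : IsTwistBase π q φ)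
  (hf' : IsLTSeries ((u : A) * π) q f') (hf : IsLTSeries π q f)
include hA hf' hf

omit [Fintype σ] [IsAdicComplete (Ideal.span {π}) A] hA hf in
/-- `f'` has `π`-divisible coefficients off `X^q` (as `π ∣ π'`). [folklore] -/
theorem dvd_coeff_sub_of_isLTSeries' (n : ℕ) :
    π ∣ PowerSeries.coeff n f' - (if n = q then 1 else 0) :=
  (Dvd.intro_left _ rfl : π ∣ (u : A) * π).trans (hf'.dvd_coeff_sub n)

omit [IsAdicComplete (Ideal.span {π}) A] in
/-- The coefficients of the twisted defect of an approximant are divisible by `π`. [folklore] -/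
theorem dvd_coeff_twistDefect' {Φ : MvPowerSeries σ A} (hΦ : Φ.constantCoeff = 0) (e : σ →₀ ℕ) :
    π ∣ MvPowerSeries.coeff e (twistDefect φ f' f Φ) := by
  obtain ⟨p, r, hp, hq, hpmem⟩ := hA.exists_prime
  exact dvd_coeff_twistDefect φ hp hq hpmem hA.dvd_map_sub_pow
    (dvd_coeff_sub_of_isLTSeries' hf') hf.dvd_coeff_sub hf.constantCoeff_eq_zero hΦ e

/-- The correction term at stage `m`: homogeneous of degree `m + 2`, its coefficient `δ_e` the
solution of the contraction equation `δ_e = -u⁻¹ c_e + u⁻¹ π^{m+1} φ(δ_e)` where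
`(D Φ)_e = π c_e`, so that `π' δ_e - π^{m+2} φ(δ_e) = -(D Φ)_e`.
[cite: LubinTate1965, Lemma p. 385] -/
def TwApprox.corr {m : ℕ} (P : TwApprox φ f' f a m) : MvPowerSeries σ A := fun e =>
  if e.degree = m + 2 then
    Classical.choose (exists_unique_eq_add_mul_map π φ hA.map_eq
      (Dvd.intro_left _ rfl : π ∣ ((u⁻¹ : Aˣ) : A) * π ^ m * π)
      (-(((u⁻¹ : Aˣ) : A) * Classical.choose (dvd_coeff_twistDefect' φ hA hf' hf P.constantCoeff_eq e))))
  else 0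

/-- The defining equation of the correction coefficient. [folklore] -/
theorem TwApprox.coeff_corr_eq {m : ℕ} (P : TwApprox φ f' f a m) {e : σ →₀ ℕ}
    (he : e.degree = m + 2) :
    MvPowerSeries.coeff e (P.corr φ hA hf' hf) =
      -(((u⁻¹ : Aˣ) : A) * Classical.choose (dvd_coeff_twistDefect' φ hA hf' hf P.constantCoeff_eq e)) +
        ((u⁻¹ : Aˣ) : A) * π ^ m * π * φ (MvPowerSeries.coeff e (P.corr φ hA hf' hf)) := by
  have hce : MvPowerSeries.coeff e (P.corr φ hA hf' hf) =
      Classical.choose (exists_unique_eq_add_mul_map π φ hA.map_eq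
        (Dvd.intro_left _ rfl : π ∣ ((u⁻¹ : Aˣ) : A) * π ^ m * π)
        (-(((u⁻¹ : Aˣ) : A) *
          Classical.choose (dvd_coeff_twistDefect' φ hA hf' hf P.constantCoeff_eq e)))) := by
    show (P.corr φ hA hf' hf) e = _
    rw [TwApprox.corr, if_pos he]
  have h := (Classical.choose_spec (exists_unique_eq_add_mul_map π φ hA.map_eq
      (Dvd.intro_left _ rfl : π ∣ ((u⁻¹ : Aˣ) : A) * π ^ m * π)
      (-(((u⁻¹ : Aˣ) : A) *
        Classical.choose (dvd_coeff_twistDefect' φ hA hf' hf P.constantCoeff_eq e))))).1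
  rw [hce]
  exact h

/-- The correction term is concentrated in degree `m + 2`. [folklore] -/
theorem TwApprox.coeff_corr_of_ne {m : ℕ} (P : TwApprox φ f' f a m) {e : σ →₀ ℕ}
    (he : e.degree ≠ m + 2) : MvPowerSeries.coeff e (P.corr φ hA hf' hf) = 0 := by
  show (P.corr φ hA hf' hf) e = 0
  rw [TwApprox.corr, if_neg he]

/-- The correction term has order `≥ m + 2`. [folklore] -/
theorem TwApprox.le_order_corr {m : ℕ} (P : TwApprox φ f' f a m) :
    ((m + 2 : ℕ) : ℕ∞) ≤ (P.corr φ hA hf' hf).order :=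
  MvPowerSeries.nat_le_order fun e he => P.coeff_corr_of_ne φ hA hf' hf (by exact_mod_cast he.ne)

/-- `π' δ - π^{m+2} δ^φ = -(D Φ)_{m+2}` coefficientwise. [folklore] -/
theorem TwApprox.coeff_C_mul_corr_sub {m : ℕ} (P : TwApprox φ f' f a m) (e : σ →₀ ℕ) :
    MvPowerSeries.coeff e (MvPowerSeries.C ((u : A) * π) * P.corr φ hA hf' hf -
        MvPowerSeries.C (π ^ (m + 2)) * MvPowerSeries.map φ (P.corr φ hA hf' hf)) =
      if e.degree = m + 2 then -MvPowerSeries.coeff e (twistDefect φ f' f P.Φ) else 0 := by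
  rw [map_sub, MvPowerSeries.coeff_C_mul, MvPowerSeries.coeff_C_mul, MvPowerSeries.coeff_map]
  split_ifs with he
  · have hc := Classical.choose_spec (dvd_coeff_twistDefect' φ hA hf' hf P.constantCoeff_eq e)
    set c := Classical.choose (dvd_coeff_twistDefect' φ hA hf' hf P.constantCoeff_eq e)
    have hδ := P.coeff_corr_eq φ hA hf' hf he
    set δ := MvPowerSeries.coeff e (P.corr φ hA hf' hf)
    rw [hc]
    have hu : (u : A) * ((u⁻¹ : Aˣ) : A) = 1 := Units.mul_inv u
    -- from `δ = -u⁻¹ c + u⁻¹ π^m π φ δ`: `u π δ - π^{m+2} φ δ = -π c`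
    have e1 : (u : A) * π * δ = (u : A) * π * (-(((u⁻¹ : Aˣ) : A) * c) +
        ((u⁻¹ : Aˣ) : A) * π ^ m * π * φ δ) := by rw [← hδ]
    rw [pow_succ, pow_succ]
    linear_combination e1 + (π ^ m * π * π * φ δ - π * c) * hu
  · rw [P.coeff_corr_of_ne φ hA hf' hf he, map_zero, mul_zero, mul_zero, sub_zero]

/-- The next approximant `Φ + δ`. [cite: LubinTate1965, Lemma p. 385] -/
def TwApprox.next {m : ℕ} (P : TwApprox φ f' f a m) : TwApprox φ f' f a (m + 1) where
  Φ := P.Φ + P.corr φ hA hf' hf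
  constantCoeff_eq := by
    rw [map_add, P.constantCoeff_eq, zero_add, ← MvPowerSeries.coeff_zero_eq_constantCoeff_apply,
      P.coeff_corr_of_ne φ hA hf' hf (by simp)]
  coeff_single i := by
    rw [map_add, P.coeff_single, P.coeff_corr_of_ne φ hA hf' hf (by simp), add_zero]
  le_order := by
    have hkey := le_order_twistDefect_sub (σ := σ) φ hf'.coeff_one hf.constantCoeff_eq_zero hf.coeff_one
      (Φ := P.Φ) (Φ' := P.Φ + P.corr φ hA hf' hf) P.constantCoeff_eq (by
        rw [map_add, P.constantCoeff_eq, zero_add,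
          ← MvPowerSeries.coeff_zero_eq_constantCoeff_apply,
          P.coeff_corr_of_ne φ hA hf' hf (by simp)]) (m := m + 1)
      (by rw [add_sub_cancel_left]; exact P.le_order_corr φ hA hf' hf)
    rw [add_sub_cancel_left] at hkey
    -- `D Φ + (π' δ - π^{m+2} δ^φ) = D Φ - (D Φ)_{m+2}` has order `≥ m + 3`
    have h2 : ((m + 1 + 2 : ℕ) : ℕ∞) ≤
        (twistDefect φ f' f P.Φ + (MvPowerSeries.C ((u : A) * π) * P.corr φ hA hf' hf -
          MvPowerSeries.C (π ^ (m + 1 + 1)) * MvPowerSeries.map φ (P.corr φ hA hf' hf))).order := by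
      refine MvPowerSeries.nat_le_order fun e he => ?_
      rw [map_add, show m + 1 + 1 = m + 2 by ring, P.coeff_C_mul_corr_sub φ hA hf' hf]
      split_ifs with hdeg
      · rw [add_neg_cancel]
      · rw [add_zero]
        refine coeff_of_lt_order (lt_of_lt_of_le ?_ P.le_order)
        have : e.degree < m + 1 + 2 := by exact_mod_cast he
        exact_mod_cast (show e.degree < m + 2 by omega)
    have : twistDefect φ f' f (P.Φ + P.corr φ hA hf' hf) =
        (twistDefect φ f' f (P.Φ + P.corr φ hA hf' hf) - twistDefect φ f' f P.Φ -
          (MvPowerSeries.C ((u : A) * π) * P.corr φ hA hf' hf -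
            MvPowerSeries.C (π ^ (m + 1 + 1)) * MvPowerSeries.map φ (P.corr φ hA hf' hf))) +
        (twistDefect φ f' f P.Φ + (MvPowerSeries.C ((u : A) * π) * P.corr φ hA hf' hf -
          MvPowerSeries.C (π ^ (m + 1 + 1)) * MvPowerSeries.map φ (P.corr φ hA hf' hf))) := by ring
    rw [this]
    exact le_trans (le_min hkey h2) min_order_le_add

/-- Passing to the next approximant does not change coefficients of degree `≠ m + 2`.
[folklore] -/
theorem TwApprox.coeff_next {m : ℕ} (P : TwApprox φ f' f a m) {e : σ →₀ ℕ} (he : e.degree ≠ m + 2) :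
    MvPowerSeries.coeff e (P.next φ hA hf' hf).Φ = MvPowerSeries.coeff e P.Φ := by
  rw [TwApprox.next, map_add, P.coeff_corr_of_ne φ hA hf' hf he, add_zero]

variable (ha : ∀ i, φ (a i) = (u : A) * a i)
include ha

/-- The sequence of approximants. [folklore] -/
def twApproxSeq : (m : ℕ) → TwApprox φ f' f a m
  | 0 => TwApprox.zero φ hf'.constantCoeff_eq_zero hf'.coeff_one hf.constantCoeff_eq_zero hf.coeff_one ha
  | m + 1 => (twApproxSeq m).next φ hA hf' hf

/-- Stability of coefficients along the sequence. [folklore] -/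
theorem coeff_twApproxSeq_of_le {m M : ℕ} (hmM : m ≤ M) {e : σ →₀ ℕ} (he : e.degree ≤ m + 1) :
    MvPowerSeries.coeff e (twApproxSeq φ hA hf' hf ha M).Φ =
      MvPowerSeries.coeff e (twApproxSeq φ hA hf' hf ha m).Φ := by
  induction M, hmM using Nat.le_induction with
  | base => rfl
  | succ M hmM ih =>
    rw [twApproxSeq, TwApprox.coeff_next φ hA hf' hf _ (by omega), ih]

/-- The limit power series. [folklore] -/
def twLimit : MvPowerSeries σ A := fun e =>
  MvPowerSeries.coeff e (twApproxSeq φ hA hf' hf ha e.degree).Φ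

/-- The coefficients of the limit of degree `≤ M + 1` are those of the `M`-th approximant.
[folklore] -/
theorem coeff_twLimit {M : ℕ} {e : σ →₀ ℕ} (he : e.degree ≤ M + 1) :
    MvPowerSeries.coeff e (twLimit φ hA hf' hf ha) =
      MvPowerSeries.coeff e (twApproxSeq φ hA hf' hf ha M).Φ := by
  change MvPowerSeries.coeff e (twApproxSeq φ hA hf' hf ha e.degree).Φ = _
  rcases Nat.lt_or_ge M e.degree with h | h
  · have : e.degree = M + 1 := by omega
    rw [this]
    exact coeff_twApproxSeq_of_le φ hA hf' hf ha (Nat.le_succ M) (by omega)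
  · exact (coeff_twApproxSeq_of_le φ hA hf' hf ha h (Nat.le_succ _)).symm

/-- The limit agrees with the `M`-th approximant to order `M + 2`. [folklore] -/
theorem le_order_twLimit_sub (M : ℕ) :
    ((M + 2 : ℕ) : ℕ∞) ≤ (twLimit φ hA hf' hf ha - (twApproxSeq φ hA hf' hf ha M).Φ).order :=
  MvPowerSeries.nat_le_order fun e he => by
    rw [map_sub, coeff_twLimit φ hA hf' hf ha (M := M) (by exact_mod_cast Nat.lt_succ_iff.mp he),
      sub_self]

/-- The limit has no constant term. [folklore] -/
theorem constantCoeff_twLimit : (twLimit φ hA hf' hf ha).constantCoeff = 0 := by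
  rw [← MvPowerSeries.coeff_zero_eq_constantCoeff_apply, coeff_twLimit φ hA hf' hf ha (M := 0) (by simp),
    MvPowerSeries.coeff_zero_eq_constantCoeff_apply]
  exact (twApproxSeq φ hA hf' hf ha 0).constantCoeff_eq

/-- The limit has the prescribed linear part. [folklore] -/
theorem coeff_twLimit_single (i : σ) :
    MvPowerSeries.coeff (Finsupp.single i 1) (twLimit φ hA hf' hf ha) = a i := by
  rw [coeff_twLimit φ hA hf' hf ha (M := 0) (by simp)]
  exact (twApproxSeq φ hA hf' hf ha 0).coeff_single i

/-- **The limit solves `f' ∘ Φ = Φ^φ ∘ (f,…,f)`.** [cite: LubinTate1965, Lemma p. 385] -/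
theorem twistDefect_twLimit : twistDefect φ f' f (twLimit φ hA hf' hf ha) = 0 := by
  have h : ∀ M : ℕ, ((M + 2 : ℕ) : ℕ∞) ≤ (twistDefect φ f' f (twLimit φ hA hf' hf ha)).order := by
    intro M
    set L := twLimit φ hA hf' hf ha
    set PM := twApproxSeq φ hA hf' hf ha M
    have hkey := le_order_twistDefect_sub (σ := σ) φ hf'.coeff_one hf.constantCoeff_eq_zero hf.coeff_one
      PM.constantCoeff_eq (constantCoeff_twLimit φ hA hf' hf ha) (m := M + 1)
      (le_order_twLimit_sub φ hA hf' hf ha M)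
    have h1 := PM.le_order
    have hT : ((M + 2 : ℕ) : ℕ∞) ≤ (MvPowerSeries.C ((u : A) * π) * (L - PM.Φ) -
        MvPowerSeries.C (π ^ (M + 1 + 1)) * MvPowerSeries.map φ (L - PM.Φ)).order := by
      rw [sub_eq_add_neg]
      refine le_trans (le_min ?_ ?_) min_order_le_add
      · exact le_trans (le_order_twLimit_sub φ hA hf' hf ha M) (le_trans le_add_self le_order_mul)
      · rw [order_neg]
        exact le_trans (le_trans (le_order_twLimit_sub φ hA hf' hf ha M) (order_le_order_map φ _))
          (le_trans le_add_self le_order_mul)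
    have : twistDefect φ f' f L =
        (twistDefect φ f' f L - twistDefect φ f' f PM.Φ -
          (MvPowerSeries.C ((u : A) * π) * (L - PM.Φ) -
            MvPowerSeries.C (π ^ (M + 1 + 1)) * MvPowerSeries.map φ (L - PM.Φ))) +
        (twistDefect φ f' f PM.Φ +
          (MvPowerSeries.C ((u : A) * π) * (L - PM.Φ) -
            MvPowerSeries.C (π ^ (M + 1 + 1)) * MvPowerSeries.map φ (L - PM.Φ))) := by
      ring
    rw [this]
    refine le_trans (le_min (le_trans (by exact_mod_cast (by omega : M + 2 ≤ M + 1 + 2)) hkey)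
      (le_trans (le_min h1 hT) min_order_le_add)) min_order_le_add
  ext e
  rw [MvPowerSeries.coeff_zero]
  have hlt : ((e.degree : ℕ) : ℕ∞) < ((e.degree + 2 : ℕ) : ℕ∞) := by exact_mod_cast (by omega)
  exact coeff_of_lt_order (lt_of_lt_of_le hlt (h e.degree))

/-! ### Uniqueness -/

omit ha in
/-- **Uniqueness** in the twisted lemma: two solutions with the same linear part coincide.
[cite: LubinTate1965, Lemma p. 385] -/
theorem eq_of_twistDefect_eq_zero {Φ Ψ : MvPowerSeries σ A} (hΦ0 : Φ.constantCoeff = 0)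
    (hΨ0 : Ψ.constantCoeff = 0)
    (hlin : ∀ i, MvPowerSeries.coeff (Finsupp.single i 1) Φ =
      MvPowerSeries.coeff (Finsupp.single i 1) Ψ)
    (hΦ : twistDefect φ f' f Φ = 0) (hΨ : twistDefect φ f' f Ψ = 0) : Φ = Ψ := by
  have key : ∀ m : ℕ, ((m + 2 : ℕ) : ℕ∞) ≤ (Ψ - Φ).order := by
    intro m
    induction m with
    | zero =>
      refine MvPowerSeries.nat_le_order fun e he => ?_
      have he2 : e.degree < 2 := by exact_mod_cast he
      rw [map_sub, sub_eq_zero]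
      interval_cases h : e.degree
      · rw [Finsupp.degree_eq_zero_iff] at h
        rw [h, MvPowerSeries.coeff_zero_eq_constantCoeff_apply,
          MvPowerSeries.coeff_zero_eq_constantCoeff_apply, hΦ0, hΨ0]
      · obtain ⟨i, rfl⟩ := exists_eq_single_of_degree_eq_one h
        exact (hlin i).symm
    | succ m ih =>
      have hkey := le_order_twistDefect_sub (σ := σ) φ hf'.coeff_one hf.constantCoeff_eq_zero
        hf.coeff_one hΦ0 hΨ0 (m := m + 1) ih
      rw [hΦ, hΨ, sub_self, zero_sub, order_neg] at hkey
      refine MvPowerSeries.nat_le_order fun e he => ?_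
      have he' : e.degree < m + 1 + 2 := by exact_mod_cast he
      rcases Nat.lt_or_ge e.degree (m + 2) with hlt | hge
      · exact coeff_of_lt_order (lt_of_lt_of_le (by exact_mod_cast hlt) ih)
      · have hdeg : e.degree = m + 2 := by omega
        have h0 := coeff_of_lt_order (lt_of_lt_of_le (by exact_mod_cast he') hkey)
        rw [map_sub, MvPowerSeries.coeff_C_mul, MvPowerSeries.coeff_C_mul, MvPowerSeries.coeff_map,
          sub_eq_zero] at h0
        -- `u π x = π^{m+2} φ x` forces `u x = π^{m+1} φ x`, a homogeneous contraction equation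
        set x := MvPowerSeries.coeff e (Ψ - Φ)
        have h1 : π * ((u : A) * x - π ^ m * π * φ x) = 0 := by
          rw [mul_sub, show π * ((u : A) * x) = (u : A) * π * x by ring, h0]; ring
        have h2 := hA.eq_zero_of_mul_eq_zero _ h1
        have h3 : x = ((u⁻¹ : Aˣ) : A) * π ^ m * π * φ x := by
          have hu : ((u⁻¹ : Aˣ) : A) * (u : A) = 1 := Units.inv_mul u
          linear_combination ((u⁻¹ : Aˣ) : A) * h2 - x * hu
        exact eq_zero_of_eq_mul_map π φ hA.map_eq
          (Dvd.intro_left _ rfl : π ∣ ((u⁻¹ : Aˣ) : A) * π ^ m * π) h3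
  have hsub : Ψ - Φ = 0 := by
    ext e
    rw [MvPowerSeries.coeff_zero]
    have hlt : ((e.degree : ℕ) : ℕ∞) < ((e.degree + 2 : ℕ) : ℕ∞) := by exact_mod_cast (by omega)
    exact coeff_of_lt_order (lt_of_lt_of_le hlt (key e.degree))
  exact (sub_eq_zero.mp hsub).symm

/-! ### The twisted Lubin–Tate lemma -/

/-- **The Frobenius-twisted Lubin–Tate lemma** (Lubin–Tate 1965, proof of the Lemma on
p. 385; Cassels–Fröhlich VI §3.7; de Shalit I §1.3–1.5).  Let `π` be a non-zero-divisor of the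
`(π)`-adically complete and separated ring `A`, `q = p^r` with `p ∈ πA`, `φ : A →+* A` with
`φ(π) = π` and `φ(a) ≡ a^q (mod π)`, `u ∈ Aˣ`, `f ∈ 𝔉_π`, `f' ∈ 𝔉_{uπ}`.  For every linear form
`Σ aᵢ Xᵢ` with `φ(aᵢ) = u aᵢ` there is a unique `Φ ∈ A⟦X₁,…,Xₙ⟧` without constant term, with
linear part `Σ aᵢ Xᵢ`, such that `f' ∘ Φ = Φ^φ ∘ (f, …, f)`.
[cite: LubinTate1965, Lemma p. 385] [cite: CasselsFrohlichANT1967, Ch. VI §3.7] -/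
theorem exists_unique_twist :
    ∃! Φ : MvPowerSeries σ A, Φ.constantCoeff = 0 ∧
      (∀ i, MvPowerSeries.coeff (Finsupp.single i 1) Φ = a i) ∧
      PowerSeries.subst Φ f' =
        MvPowerSeries.subst (fun i : σ => PowerSeries.subst (MvPowerSeries.X i) f)
          (MvPowerSeries.map φ Φ) := by
  refine ⟨twLimit φ hA hf' hf ha, ⟨constantCoeff_twLimit φ hA hf' hf ha,
    coeff_twLimit_single φ hA hf' hf ha, sub_eq_zero.mp (twistDefect_twLimit φ hA hf' hf ha)⟩, ?_⟩
  rintro Ψ ⟨hΨ0, hΨ1, hΨ⟩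
  refine (eq_of_twistDefect_eq_zero φ hA hf' hf (constantCoeff_twLimit φ hA hf' hf ha) hΨ0
    (fun i => ?_) (twistDefect_twLimit φ hA hf' hf ha) (sub_eq_zero.mpr hΨ)).symm
  rw [coeff_twLimit_single, hΨ1]

end Existence

end LubinTate

end Literature.NumberTheory.GaloisRepresentations

end
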